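import Summits.ValiantsHypothesis.ValiantsHypothesis.Theorems.ValuativeGCTValuativeFlipPerUniversalPlethysm
import Summits.ValiantsHypothesis.ValiantsHypothesis.Theorems.ValuativeGCTValuativeBound
import Literature.Computability.AlgebraicComplexity.VPDeterminantalQPProofs
import Literature.Computability.AlgebraicComplexity.DeterminantalComplexityUniform

/-!
# The plethysm FLOOR is common to both sides: the determinant pays the padded-forms plethysm too
# (crux `ValuativeGCT.ValuativeFlip`, stmt-ValiantsHypothesis-12624; wall-breaker axis k14 gen 1 seat 3,
# "plethysm tables for seedRichness (small cases certified)")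

Gen 0 of this axis showed that plethysm CEILINGS are common to the two sides of the crux
(`mult ≤ a_λ(δ[m])` for the padded permanent and for the determinant alike, `…SeedCeiling.lean`).
This file shows the same for the plethysm FLOOR of a tail position.  The sibling axis k9 (seat 3,
`…PerUniversalPlethysm.lean`) paid the PER side of the tail in plethysm currency — for
`N₀(k) ≤ N ≤ m = k + j`, `N₀(k) < m`, every `λ ⊢ kδ` with at most `k²` parts has
`a_λ(δ[k]) ≤ mult_{(λ♯m)*} ℂ[Δ_m(X₀₀^{m-N} per_N)]` — and reduced the tail stub `stub_tailFlip` to the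
purely determinant-side census `dim T_U(λ♯m) < a_λ(δ[k])` (`flipBody_of_plethysmCensus`).

**That census is never satisfiable.**  The determinant is at least as universal as the permanent:
by Valiant's construction in the size-additive form of the tree (`HasInvRepr`, BCS 1997 Thm. (21.27)),
EVERY form of degree `k` in the `k²` variables is the determinant of an affine matrix of the explicit
size `C_det(k) = #degMonomials(k², k) · (2k + 4) + 1 ≤ N₀(k)` (`plethysmFloor_hasDetRepr`,
`plethysmFloor_cdet_le`); so Ikenmeyer–Panova's lifting inequality (Prop. 2.6(b) with Prop. 2.5,
`plethysmCoeff_le_orbitMultiplicity_rowLift`) gives `a_λ(δ[k]) ≤ K_m((λ♯m)*)` for every `m ≥ C_det(k)`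
and EVERY `λ` (no `λ₂ ≤ k`, no small-body hypothesis) — `plethysmFloor_det` —, and the proved route crux
`ValuativeBound` (`K_m ≤ dim T_U`, stmt-12625) moves the floor under every valuative truncation:
`a_λ(δ[k]) ≤ dim T_U(λ♯m)` for every admissible centre (`plethysmFloor_trunc`).  Hence:

* `plethysmFloor_not_census`, `not_hcensus_of_flipBody_of_plethysmCensus` — the hypothesis of
  `flipBody_of_plethysmCensus` is FALSE on its entire range (`N₀(k) < m` already forces `C_det(k) ≤ m`);
  the reduction of the tail to "a valuative census below a plethysm coefficient" is vacuous;
* `plethysmFloor_kronecker` — the same floor under the Kronecker majorant: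
  `a_λ(δ[k]) ≤ g(λ♯m, m × δ, m × δ)` for all `m ≥ C_det(k)` and ALL `λ` (IP Prop. 2.8 without
  Manivel's body hypothesis, at the lifted shape);
* `plethysmFloor_sandwich` — on a lifted shape both sides are pinned between the SAME two plethysm
  numbers: `a_λ(δ[k]) ≤ K_m ≤ dim T_U` and `mult_pp ≤ a_{λ♯m}(δ[m])`;
* `flip_rowLift_necessary` — so a flip at a lifted shape `λ♯m` (any centre, any inner size `N ≤ m`)
  needs (i) a PER-SPECIFIC EXCESS `a_λ(δ[k]) < mult_pp((λ♯m)*)` over the universal floor,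
  (ii) STRICT inner-plethysm growth `a_λ(δ[k]) < a_{λ♯m}(δ[m])`, (iii) instability `λ₂ > k`
  (exact stability `plethysmCoeff_rowLift_eq` otherwise) — the table test of this axis for the tail.

What remains of the tail on this axis: per-side multiplicity IN EXCESS of the universal plethysm floor
(explicit per-specific highest-weight vectors beyond the lifted ones), against `dim T_U`; plethysm
currency alone can never flip.

Sources: L. G. Valiant, STOC 1979 §2; Bürgisser–Clausen–Shokrollahi 1997 Thm. (21.27);
C. Ikenmeyer, G. Panova, Adv. Math. 319 (2017) Prop. 2.5, 2.6(b), Lemma 2.7, Prop. 2.8;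
Bürgisser–Ikenmeyer–Panova, J. AMS 32 (2019) Prop. 5.6(2); BLMW, SIAM J. Comput. 40 (2011) §4.4, §6.4.
-/

-- `Summit.ValiantsHypothesis.ValiantsHypothesis.…` is the tree's mandated single-conjunct layout (Sub = Summit).
set_option linter.dupNamespace false

namespace Summit.ValiantsHypothesis.ValiantsHypothesis.Theorems.ValuativeFlip

open MvPolynomial
open scoped BigOperators
open Literature.NumberTheory.DiophantineGeometry
open Literature.Computability.AlgebraicComplexity
open Literature.Computability.Complexity

noncomputable section

/-! ## Effective universality of the determinant for forms (Valiant, size-additive form) -/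

/-- The affine factor list of a monomial multiplies out to the monomial:
`C a · ∏ (variables of d, with multiplicity) = a x^d`. [folklore] -/
theorem plethysmFloor_prod_factors {σ : Type} (d : σ →₀ ℕ) (a : ℂ) :
    (C a :: ((Finsupp.toMultiset d).map (X : σ → MvPolynomial σ ℂ)).toList).prod = monomial d a := by
  rw [List.prod_cons, Multiset.prod_toList, Finsupp.toMultiset_map, Finsupp.prod_toMultiset,
    Finsupp.prod_mapDomain_index (fun _ => pow_zero _) (fun _ _ _ => pow_add _ _ _), monomial_eq]

/-- The affine factor list of a monomial `a x^d` has `deg d + 1` entries. [folklore] -/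
theorem plethysmFloor_length_factors {σ : Type} (d : σ →₀ ℕ) (a : ℂ) :
    (C a :: ((Finsupp.toMultiset d).map (X : σ → MvPolynomial σ ℂ)).toList).length = d.degree + 1 := by
  rw [List.length_cons, Multiset.length_toList, Multiset.card_map, Finsupp.card_toMultiset,
    Finsupp.degree_apply]
  rfl

/-- Every entry of the affine factor list of a monomial is affine (a constant or a variable).
[folklore] -/
theorem plethysmFloor_totalDegree_factors {σ : Type} (d : σ →₀ ℕ) (a : ℂ) {p : MvPolynomial σ ℂ}
    (hp : p ∈ (C a :: ((Finsupp.toMultiset d).map (X : σ → MvPolynomial σ ℂ)).toList)) :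
    p.totalDegree ≤ 1 := by
  rw [List.mem_cons, Multiset.mem_toList, Multiset.mem_map] at hp
  rcases hp with rfl | ⟨i, -, rfl⟩
  · rw [totalDegree_C]
    exact Nat.zero_le _
  · rw [totalDegree_X]

/-- **A monomial of degree `e` is read out of a unipotent affine matrix of size `2(e + 1) + 2`**
(`HasInvRepr`, the size-additive form of Valiant's construction: affine factors cost `2`, products add).
[Valiant 1979 §2; BCS 1997 Thm. (21.27), proof, Cases 1–2] -/
theorem plethysmFloor_hasInvRepr_monomial {σ : Type} (d : σ →₀ ℕ) (a : ℂ) :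
    HasInvRepr (monomial d a : MvPolynomial σ ℂ) ((d.degree + 1) * 2 + 2) := by
  have h := HasInvRepr.list_prod
    (T := (C a :: ((Finsupp.toMultiset d).map (X : σ → MvPolynomial σ ℂ)).toList)) (b := 2)
    (fun p hp => HasInvRepr.of_totalDegree_le_one (plethysmFloor_totalDegree_factors d a hp))
  rwa [plethysmFloor_prod_factors, plethysmFloor_length_factors] at h

/-- **Effective universality of the determinant for forms** (the explicit `dcmax` of Ikenmeyer–Panova's
Lemma 2.7, in the tree's size-additive currency): every form `f` of degree `k` in the finitely many
variables `σ` is the determinant of an affine matrix of size `#degMonomials(σ, k) · (2k + 4) + 1`,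
a size depending only on `(σ, k)`.  Proof: `f = ∑_{|d| = k} coeff_d(f) x^d`; each monomial costs
`2(k+1) + 2` (`plethysmFloor_hasInvRepr_monomial`), sums add (`HasInvRepr.finset_sum`), and the
bordered matrix converts the read-out into a determinant at the price of one more row
(`HasInvRepr.hasDetRepr`). [Valiant 1979 §2; BCS 1997 Thm. (21.27); Ikenmeyer–Panova 2017 Lemma 2.7] -/
theorem plethysmFloor_hasDetRepr {σ : Type} [Fintype σ] [DecidableEq σ] (k' : ℕ)
    {f : MvPolynomial σ ℂ} (hf : f.IsHomogeneous k') :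
    HasDetRepr f ((degMonomials σ k').card * ((k' + 1) * 2 + 2) + 1) := by
  classical
  have hsupp : f.support ⊆ degMonomials σ k' := support_subset_finsuppAntidiag_of_isHomogeneous hf
  have hmono : ∀ d ∈ degMonomials σ k',
      HasInvRepr (monomial d (coeff d f) : MvPolynomial σ ℂ) ((k' + 1) * 2 + 2) := by
    intro d hd
    have hdeg : d.degree = k' := mem_degMonomials_iff.mp hd
    rw [← hdeg]
    exact plethysmFloor_hasInvRepr_monomial d (coeff d f)
  have hsum := HasInvRepr.finset_sum (degMonomials σ k') hmono
  rw [← eq_sum_monomial_coeff_of_support_subset hsupp] at hsum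
  exact hsum.hasDetRepr

/-- **The determinant's universal size is below the permanent's**: `C_det(k) = D·(2k+4) + 1 ≤
N₀(k) = 2·D·(k + k² + 2) + 2` (`D = #degMonomials(MatIdx k, k)`), so every position in the range of
`flipBody_of_plethysmCensus` (`N₀(k) < m`) is above the determinant's threshold. [folklore arithmetic] -/
theorem plethysmFloor_cdet_le (k' : ℕ) :
    (degMonomials (MatIdx k') k').card * ((k' + 1) * 2 + 2) + 1 ≤
      2 * ((degMonomials (MatIdx k') k').card * (k' + k' * k' + 2)) + 2 := by
  have key : 2 * ((degMonomials (MatIdx k') k').card * (k' + k' * k' + 2)) + 2 =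
      ((degMonomials (MatIdx k') k').card * ((k' + 1) * 2 + 2) + 1) +
        (2 * ((degMonomials (MatIdx k') k').card * (k' * k')) + 1) := by
    ring
  rw [key]
  exact Nat.le_add_right _ _

/-! ## The plethysm floor of the determinant, of the Kronecker majorant, and of every truncation -/

/-- **Plethysm floor of the determinant (effective Ikenmeyer–Panova 2.6(b) + 2.5 + 2.7, ALL shapes).**
For `m = k + j ≥ C_det(k) = #degMonomials(k², k)·(2k+4) + 1` and every `λ ⊢ kδ` with at most `k²`
parts: `a_λ(δ[k]) ≤ K_m((λ♯m)*) = mult_{(λ♯m)*} ℂ[Δ(det_m)]`.  No hypothesis on `λ₂` or on the body: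
the determinant orbit closure contains every padded form of level `k`, and the Kadish–Landsberg /
BIP lift is injective modulo its ideal. [Ikenmeyer–Panova 2017 Prop. 2.5, 2.6(b), Lemma 2.7; this file] -/
theorem plethysmFloor_det {k' : ℕ} [NeZero k'] (j : ℕ) [NeZero (k' + j)]
    (hj : (degMonomials (MatIdx k') k').card * ((k' + 1) * 2 + 2) + 1 ≤ k' + j)
    {δ : ℕ} (lam : Nat.Partition (k' * δ)) (hlam : lam.parts.card ≤ k' * k') :
    plethysmCoeff ℂ (MatIdx k') k' (partitionWeightLex k' lam) ≤
      orbitMultiplicity ℂ (detFormLex ℂ (k' + j)) (k' + j) (partitionWeightLex (k' + j) (rowLift lam j)) :=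
  plethysmCoeff_le_orbitMultiplicity_rowLift lam hlam j fun _ hf =>
    HasDetRepr.mono_holds (plethysmFloor_hasDetRepr k' hf) hj

/-- The lifted shape has at most `(k+j)²` parts (bookkeeping of `flipBody_of_plethysmCensus`). [folklore] -/
theorem plethysmFloor_card_parts_rowLift {k' : ℕ} [NeZero k'] (j : ℕ) {δ : ℕ}
    (lam : Nat.Partition (k' * δ)) (hlam : lam.parts.card ≤ k' * k') :
    (rowLift lam j).parts.card ≤ (k' + j) * (k' + j) := by
  have hk1 : 1 ≤ k' * k' := Nat.one_le_iff_ne_zero.2 (mul_ne_zero (NeZero.ne k') (NeZero.ne k'))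
  exact ((card_parts_rowLift_le lam j).trans (max_le hlam hk1)).trans
    (Nat.mul_le_mul (Nat.le_add_right k' j) (Nat.le_add_right k' j))

/-- **Plethysm floor of the Kronecker majorant (all shapes).**  For `m = k + j ≥ C_det(k)` and every
`λ ⊢ kδ` with at most `k²` parts: `a_λ(δ[k]) ≤ g(λ♯m, m × δ, m × δ)` — Ikenmeyer–Panova's Prop. 2.8
at the LIFTED shape, where Manivel's body hypothesis `|λ̄| ≤ k` is not needed (algebraic Peter–Weyl
`orbitMultiplicity_det_le_kroneckerCoeff_holds` over `plethysmFloor_det`).  The no-cut truncation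
`T_⊥` is majorised by the same `g` (KroneckerCensus of this crux), so rectangular Kronecker tables
never drop below the level-`k` plethysm table at lifted shapes. [Ikenmeyer–Panova 2017 Prop. 2.8; this file] -/
theorem plethysmFloor_kronecker {k' : ℕ} [NeZero k'] (j : ℕ) [NeZero (k' + j)]
    (hj : (degMonomials (MatIdx k') k').card * ((k' + 1) * 2 + 2) + 1 ≤ k' + j)
    {δ : ℕ} (lam : Nat.Partition (k' * δ)) (hlam : lam.parts.card ≤ k' * k') :
    plethysmCoeff ℂ (MatIdx k') k' (partitionWeightLex k' lam) ≤
      kroneckerCoeff ℂ (rowLift lam j) (Nat.Partition.rectangle (k' + j) δ)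
        (Nat.Partition.rectangle (k' + j) δ) :=
  (plethysmFloor_det j hj lam hlam).trans
    (orbitMultiplicity_det_le_kroneckerCoeff_holds (k := ℂ) (rowLift lam j)
      (plethysmFloor_card_parts_rowLift j lam hlam))

/-- **Plethysm floor under every valuative truncation.**  For `m = k + j ≥ C_det(k)`, every admissible
centre `(U, r)` and every `λ ⊢ kδ` with at most `k²` parts:
`a_λ(δ[k]) ≤ dim T_U(λ♯m)` (`T_U` verbatim the truncation of the route decls `ValuativeFlip` /
`ValuativeBound` at size `m`, degree `δ`, weight `(λ♯m)*`) — the floor of the determinant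
(`plethysmFloor_det`) pushed under the truncation by the proved route crux `ValuativeBound`
(`K_m ≤ dim T_U`, stmt-12625). [this file; Theorems/ValuativeGCTValuativeBound.lean] -/
theorem plethysmFloor_trunc {k' : ℕ} [NeZero k'] (j : ℕ) [NeZero (k' + j)]
    (hj : (degMonomials (MatIdx k') k').card * ((k' + 1) * 2 + 2) + 1 ≤ k' + j)
    {δ : ℕ} (lam : Nat.Partition (k' * δ)) (hlam : lam.parts.card ≤ k' * k')
    (U : Submodule ℂ (MatIdx (k' + j) → ℂ)) (r : ℕ)
    (hU : ∀ u ∈ U, (Matrix.of fun a b : Fin (k' + j) => u (toLex (a, b))).rank ≤ r) :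
    plethysmCoeff ℂ (MatIdx k') k' (partitionWeightLex k' lam) ≤
      Module.finrank ℂ ↥(MvPolynomial.homogeneousSubmodule (MatIdx (k' + j) × MatIdx (k' + j)) ℂ ((k' + j) * δ) ⊓
                ((MvPolynomial.vanishingIdeal ℂ
                    {p : MatIdx (k' + j) × MatIdx (k' + j) → ℂ | ∀ j' : MatIdx (k' + j), (fun i => p (j', i)) ∈ U}) ^ (δ * ((k' + j) - r))).restrictScalars ℂ ⊓
                (⨅ (M : Matrix (MatIdx (k' + j)) (MatIdx (k' + j)) ℂ)
                  (_ : linSubst (MatIdx (k' + j)) ℂ M (detFormLex ℂ (k' + j)) = detFormLex ℂ (k' + j)),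
                  LinearMap.ker ((MvPolynomial.aeval fun p : MatIdx (k' + j) × MatIdx (k' + j) =>
                      ∑ l : MatIdx (k' + j), M l p.2 •
                        (MvPolynomial.X (p.1, l) : MvPolynomial (MatIdx (k' + j) × MatIdx (k' + j)) ℂ)).toLinearMap -
                    (LinearMap.id : MvPolynomial (MatIdx (k' + j) × MatIdx (k' + j)) ℂ →ₗ[ℂ] MvPolynomial (MatIdx (k' + j) × MatIdx (k' + j)) ℂ))) ⊓
                (⨅ (g : Matrix.GeneralLinearGroup (MatIdx (k' + j)) ℂ) (_ : IsUpperTriangular g),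
                  LinearMap.ker ((MvPolynomial.aeval fun p : MatIdx (k' + j) × MatIdx (k' + j) =>
                      ∑ l : MatIdx (k' + j), ((g⁻¹ : Matrix.GeneralLinearGroup (MatIdx (k' + j)) ℂ) :
                        Matrix (MatIdx (k' + j)) (MatIdx (k' + j)) ℂ) p.1 l •
                          (MvPolynomial.X (l, p.2) : MvPolynomial (MatIdx (k' + j) × MatIdx (k' + j)) ℂ)).toLinearMap -
                    weightChar ((Weight.dualOfPartition ((k' + j) * (k' + j)) (rowLift lam j)).toMatIdx : Weight (MatIdx (k' + j))) g •
                      (LinearMap.id : MvPolynomial (MatIdx (k' + j) × MatIdx (k' + j)) ℂ →ₗ[ℂ] MvPolynomial (MatIdx (k' + j) × MatIdx (k' + j)) ℂ)))) := by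
  have h1 := plethysmFloor_det j hj lam hlam
  have h2 := Summit.ValiantsHypothesis.ValiantsHypothesis.Theorems.ValuativeBound.ValuativeBound_proof
    (k' + j) U r hU δ (rowLift lam j) (plethysmFloor_card_parts_rowLift j lam hlam)
  exact h1.trans h2

/-- **The plethysm-currency census is never satisfiable.**  For `m = k + j ≥ C_det(k)`, no admissible
centre and no `λ ⊢ kδ` (`≤ k²` parts) has `dim T_U(λ♯m) < a_λ(δ[k])`. [this file] -/
theorem plethysmFloor_not_census {k' : ℕ} [NeZero k'] (j : ℕ) [NeZero (k' + j)]
    (hj : (degMonomials (MatIdx k') k').card * ((k' + 1) * 2 + 2) + 1 ≤ k' + j)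
    {δ : ℕ} (lam : Nat.Partition (k' * δ)) (hlam : lam.parts.card ≤ k' * k')
    (U : Submodule ℂ (MatIdx (k' + j) → ℂ)) (r : ℕ)
    (hU : ∀ u ∈ U, (Matrix.of fun a b : Fin (k' + j) => u (toLex (a, b))).rank ≤ r) :
    ¬ Module.finrank ℂ ↥(MvPolynomial.homogeneousSubmodule (MatIdx (k' + j) × MatIdx (k' + j)) ℂ ((k' + j) * δ) ⊓
                ((MvPolynomial.vanishingIdeal ℂ
                    {p : MatIdx (k' + j) × MatIdx (k' + j) → ℂ | ∀ j' : MatIdx (k' + j), (fun i => p (j', i)) ∈ U}) ^ (δ * ((k' + j) - r))).restrictScalars ℂ ⊓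
                (⨅ (M : Matrix (MatIdx (k' + j)) (MatIdx (k' + j)) ℂ)
                  (_ : linSubst (MatIdx (k' + j)) ℂ M (detFormLex ℂ (k' + j)) = detFormLex ℂ (k' + j)),
                  LinearMap.ker ((MvPolynomial.aeval fun p : MatIdx (k' + j) × MatIdx (k' + j) =>
                      ∑ l : MatIdx (k' + j), M l p.2 •
                        (MvPolynomial.X (p.1, l) : MvPolynomial (MatIdx (k' + j) × MatIdx (k' + j)) ℂ)).toLinearMap -
                    (LinearMap.id : MvPolynomial (MatIdx (k' + j) × MatIdx (k' + j)) ℂ →ₗ[ℂ] MvPolynomial (MatIdx (k' + j) × MatIdx (k' + j)) ℂ))) ⊓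
                (⨅ (g : Matrix.GeneralLinearGroup (MatIdx (k' + j)) ℂ) (_ : IsUpperTriangular g),
                  LinearMap.ker ((MvPolynomial.aeval fun p : MatIdx (k' + j) × MatIdx (k' + j) =>
                      ∑ l : MatIdx (k' + j), ((g⁻¹ : Matrix.GeneralLinearGroup (MatIdx (k' + j)) ℂ) :
                        Matrix (MatIdx (k' + j)) (MatIdx (k' + j)) ℂ) p.1 l •
                          (MvPolynomial.X (l, p.2) : MvPolynomial (MatIdx (k' + j) × MatIdx (k' + j)) ℂ)).toLinearMap -
                    weightChar ((Weight.dualOfPartition ((k' + j) * (k' + j)) (rowLift lam j)).toMatIdx : Weight (MatIdx (k' + j))) g •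
                      (LinearMap.id : MvPolynomial (MatIdx (k' + j) × MatIdx (k' + j)) ℂ →ₗ[ℂ] MvPolynomial (MatIdx (k' + j) × MatIdx (k' + j)) ℂ)))) <
      plethysmCoeff ℂ (MatIdx k') k' (partitionWeightLex k' lam) :=
  not_lt.mpr (plethysmFloor_trunc j hj lam hlam U r hU)

/-- **`flipBody_of_plethysmCensus` is vacuous on its whole range.**  In exactly the hypotheses of
that theorem — `N₀(k) ≤ N`, `N₀(k) < k + j`, `N ≤ k + j`, `λ ⊢ kδ` with `≤ k²` parts, an admissible
centre `(U, r)` — its census hypothesis `dim T_U(λ♯(k+j)) < a_λ(δ[k])` is FALSE: `N₀(k) < m` puts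
`m` above the determinant's universal size `C_det(k) ≤ N₀(k)` (`plethysmFloor_cdet_le`), where the
determinant pays the same plethysm floor (`plethysmFloor_not_census`).  (The hypotheses `hN₀`, `hN`
are kept only to match that signature.)  The per side paid in plethysm currency can never flip; the
tail needs per-side multiplicity in EXCESS of the universal floor. [this file] -/
theorem not_hcensus_of_flipBody_of_plethysmCensus {k' : ℕ} [NeZero k'] (j N : ℕ) [NeZero (k' + j)]
    (_hN₀ : 2 * ((degMonomials (MatIdx k') k').card * (k' + k' * k' + 2)) + 2 ≤ N)
    (hN₀' : 2 * ((degMonomials (MatIdx k') k').card * (k' + k' * k' + 2)) + 2 < k' + j)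
    (_hN : N ≤ k' + j) {δ : ℕ} (lam : Nat.Partition (k' * δ)) (hlam : lam.parts.card ≤ k' * k')
    (U : Submodule ℂ (MatIdx (k' + j) → ℂ)) (r : ℕ)
    (hU : ∀ u ∈ U, (Matrix.of fun a b : Fin (k' + j) => u (toLex (a, b))).rank ≤ r) :
    ¬ Module.finrank ℂ ↥(MvPolynomial.homogeneousSubmodule (MatIdx (k' + j) × MatIdx (k' + j)) ℂ ((k' + j) * δ) ⊓
                ((MvPolynomial.vanishingIdeal ℂ
                    {p : MatIdx (k' + j) × MatIdx (k' + j) → ℂ | ∀ j' : MatIdx (k' + j), (fun i => p (j', i)) ∈ U}) ^ (δ * ((k' + j) - r))).restrictScalars ℂ ⊓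
                (⨅ (M : Matrix (MatIdx (k' + j)) (MatIdx (k' + j)) ℂ)
                  (_ : linSubst (MatIdx (k' + j)) ℂ M (detFormLex ℂ (k' + j)) = detFormLex ℂ (k' + j)),
                  LinearMap.ker ((MvPolynomial.aeval fun p : MatIdx (k' + j) × MatIdx (k' + j) =>
                      ∑ l : MatIdx (k' + j), M l p.2 •
                        (MvPolynomial.X (p.1, l) : MvPolynomial (MatIdx (k' + j) × MatIdx (k' + j)) ℂ)).toLinearMap -
                    (LinearMap.id : MvPolynomial (MatIdx (k' + j) × MatIdx (k' + j)) ℂ →ₗ[ℂ] MvPolynomial (MatIdx (k' + j) × MatIdx (k' + j)) ℂ))) ⊓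
                (⨅ (g : Matrix.GeneralLinearGroup (MatIdx (k' + j)) ℂ) (_ : IsUpperTriangular g),
                  LinearMap.ker ((MvPolynomial.aeval fun p : MatIdx (k' + j) × MatIdx (k' + j) =>
                      ∑ l : MatIdx (k' + j), ((g⁻¹ : Matrix.GeneralLinearGroup (MatIdx (k' + j)) ℂ) :
                        Matrix (MatIdx (k' + j)) (MatIdx (k' + j)) ℂ) p.1 l •
                          (MvPolynomial.X (l, p.2) : MvPolynomial (MatIdx (k' + j) × MatIdx (k' + j)) ℂ)).toLinearMap -
                    weightChar ((Weight.dualOfPartition ((k' + j) * (k' + j)) (rowLift lam j)).toMatIdx : Weight (MatIdx (k' + j))) g •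
                      (LinearMap.id : MvPolynomial (MatIdx (k' + j) × MatIdx (k' + j)) ℂ →ₗ[ℂ] MvPolynomial (MatIdx (k' + j) × MatIdx (k' + j)) ℂ)))) <
      plethysmCoeff ℂ (MatIdx k') k' (partitionWeightLex k' lam) :=
  plethysmFloor_not_census j (((plethysmFloor_cdet_le k').trans hN₀'.le)) lam hlam U r hU

/-! ## The sandwich on lifted shapes and the necessary conditions for a flip there -/

/-- **The plethysm sandwich of a lifted shape.**  For `m = k + j ≥ C_det(k)`, `N ≤ m`, every
admissible centre `(U, r)` and every `λ ⊢ kδ` with at most `k²` parts, BOTH sides of the crux at the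
Kadish–Landsberg shape `λ♯m` lie between the same two plethysm numbers:
`a_λ(δ[k]) ≤ K_m((λ♯m)*) ≤ dim T_U(λ♯m)` and `mult_{(λ♯m)*} ℂ[Δ_m(X₀₀^{m-N} per_N)] ≤ a_{λ♯m}(δ[m])`
(floor: this file; `ValuativeBound`; ceiling: BLMW Prop. 4.4.1 `orbitMultiplicity_le_plethysmCoeff_holds`).
[this file; BLMW 2011 Prop. 4.4.1] -/
theorem plethysmFloor_sandwich {k' : ℕ} [NeZero k'] (j N : ℕ) [NeZero (k' + j)]
    (hj : (degMonomials (MatIdx k') k').card * ((k' + 1) * 2 + 2) + 1 ≤ k' + j) (hN : N ≤ k' + j)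
    {δ : ℕ} (lam : Nat.Partition (k' * δ)) (hlam : lam.parts.card ≤ k' * k')
    (U : Submodule ℂ (MatIdx (k' + j) → ℂ)) (r : ℕ)
    (hU : ∀ u ∈ U, (Matrix.of fun a b : Fin (k' + j) => u (toLex (a, b))).rank ≤ r) :
    plethysmCoeff ℂ (MatIdx k') k' (partitionWeightLex k' lam) ≤
        orbitMultiplicity ℂ (detFormLex ℂ (k' + j)) (k' + j) (partitionWeightLex (k' + j) (rowLift lam j)) ∧
      orbitMultiplicity ℂ (detFormLex ℂ (k' + j)) (k' + j) (partitionWeightLex (k' + j) (rowLift lam j)) ≤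
        Module.finrank ℂ ↥(MvPolynomial.homogeneousSubmodule (MatIdx (k' + j) × MatIdx (k' + j)) ℂ ((k' + j) * δ) ⊓
                ((MvPolynomial.vanishingIdeal ℂ
                    {p : MatIdx (k' + j) × MatIdx (k' + j) → ℂ | ∀ j' : MatIdx (k' + j), (fun i => p (j', i)) ∈ U}) ^ (δ * ((k' + j) - r))).restrictScalars ℂ ⊓
                (⨅ (M : Matrix (MatIdx (k' + j)) (MatIdx (k' + j)) ℂ)
                  (_ : linSubst (MatIdx (k' + j)) ℂ M (detFormLex ℂ (k' + j)) = detFormLex ℂ (k' + j)),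
                  LinearMap.ker ((MvPolynomial.aeval fun p : MatIdx (k' + j) × MatIdx (k' + j) =>
                      ∑ l : MatIdx (k' + j), M l p.2 •
                        (MvPolynomial.X (p.1, l) : MvPolynomial (MatIdx (k' + j) × MatIdx (k' + j)) ℂ)).toLinearMap -
                    (LinearMap.id : MvPolynomial (MatIdx (k' + j) × MatIdx (k' + j)) ℂ →ₗ[ℂ] MvPolynomial (MatIdx (k' + j) × MatIdx (k' + j)) ℂ))) ⊓
                (⨅ (g : Matrix.GeneralLinearGroup (MatIdx (k' + j)) ℂ) (_ : IsUpperTriangular g),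
                  LinearMap.ker ((MvPolynomial.aeval fun p : MatIdx (k' + j) × MatIdx (k' + j) =>
                      ∑ l : MatIdx (k' + j), ((g⁻¹ : Matrix.GeneralLinearGroup (MatIdx (k' + j)) ℂ) :
                        Matrix (MatIdx (k' + j)) (MatIdx (k' + j)) ℂ) p.1 l •
                          (MvPolynomial.X (l, p.2) : MvPolynomial (MatIdx (k' + j) × MatIdx (k' + j)) ℂ)).toLinearMap -
                    weightChar ((Weight.dualOfPartition ((k' + j) * (k' + j)) (rowLift lam j)).toMatIdx : Weight (MatIdx (k' + j))) g •
                      (LinearMap.id : MvPolynomial (MatIdx (k' + j) × MatIdx (k' + j)) ℂ →ₗ[ℂ] MvPolynomial (MatIdx (k' + j) × MatIdx (k' + j)) ℂ)))) ∧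
      orbitMultiplicity ℂ (paddedPerFormLex ℂ N (k' + j)) (k' + j) (partitionWeightLex (k' + j) (rowLift lam j)) ≤
        plethysmCoeff ℂ (MatIdx (k' + j)) (k' + j) (partitionWeightLex (k' + j) (rowLift lam j)) := by
  refine ⟨plethysmFloor_det j hj lam hlam, ?_, ?_⟩
  · exact Summit.ValiantsHypothesis.ValiantsHypothesis.Theorems.ValuativeBound.ValuativeBound_proof
      (k' + j) U r hU δ (rowLift lam j) (plethysmFloor_card_parts_rowLift j lam hlam)
  · exact orbitMultiplicity_le_plethysmCoeff_holds _ (NeZero.ne (k' + j))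
      (paddedPerFormLex_isHomogeneous ℂ hN) _

/-- **What a flip at a lifted shape needs (the table test of this axis for the tail).**  If at a
position `(N, m = k + j)`, `N ≤ m`, `m ≥ C_det(k)`, some admissible centre `(U, r)` flips at the
Kadish–Landsberg shape `λ♯m` of some `λ ⊢ kδ` with at most `k²` parts —
`dim T_U(λ♯m) < mult_{(λ♯m)*} ℂ[Δ_m(X₀₀^{m-N} per_N)]`, the body of `ValuativeFlip` at that witness —
then (i) the padded permanent carries `λ♯m` with multiplicity STRICTLY ABOVE the universal plethysm
floor `a_λ(δ[k])` (a per-SPECIFIC excess), (ii) the inner plethysm grows STRICTLY under the lift,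
`a_λ(δ[k]) < a_{λ♯m}(δ[m])`, and (iii) the shape is unstable, `λ₂ > k` (for `λ₂ ≤ k` the inner plethysm
is exactly stable, `plethysmCoeff_rowLift_eq`, contradicting (ii)). [this file; BIP 2019 Prop. 5.6(2)] -/
theorem flip_rowLift_necessary {k' : ℕ} [NeZero k'] (j N : ℕ) [NeZero (k' + j)]
    (hj : (degMonomials (MatIdx k') k').card * ((k' + 1) * 2 + 2) + 1 ≤ k' + j) (hN : N ≤ k' + j)
    {δ : ℕ} (lam : Nat.Partition (k' * δ)) (hlam : lam.parts.card ≤ k' * k')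
    (U : Submodule ℂ (MatIdx (k' + j) → ℂ)) (r : ℕ)
    (hU : ∀ u ∈ U, (Matrix.of fun a b : Fin (k' + j) => u (toLex (a, b))).rank ≤ r)
    (hflip : Module.finrank ℂ ↥(MvPolynomial.homogeneousSubmodule (MatIdx (k' + j) × MatIdx (k' + j)) ℂ ((k' + j) * δ) ⊓
                ((MvPolynomial.vanishingIdeal ℂ
                    {p : MatIdx (k' + j) × MatIdx (k' + j) → ℂ | ∀ j' : MatIdx (k' + j), (fun i => p (j', i)) ∈ U}) ^ (δ * ((k' + j) - r))).restrictScalars ℂ ⊓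
                (⨅ (M : Matrix (MatIdx (k' + j)) (MatIdx (k' + j)) ℂ)
                  (_ : linSubst (MatIdx (k' + j)) ℂ M (detFormLex ℂ (k' + j)) = detFormLex ℂ (k' + j)),
                  LinearMap.ker ((MvPolynomial.aeval fun p : MatIdx (k' + j) × MatIdx (k' + j) =>
                      ∑ l : MatIdx (k' + j), M l p.2 •
                        (MvPolynomial.X (p.1, l) : MvPolynomial (MatIdx (k' + j) × MatIdx (k' + j)) ℂ)).toLinearMap -
                    (LinearMap.id : MvPolynomial (MatIdx (k' + j) × MatIdx (k' + j)) ℂ →ₗ[ℂ] MvPolynomial (MatIdx (k' + j) × MatIdx (k' + j)) ℂ))) ⊓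
                (⨅ (g : Matrix.GeneralLinearGroup (MatIdx (k' + j)) ℂ) (_ : IsUpperTriangular g),
                  LinearMap.ker ((MvPolynomial.aeval fun p : MatIdx (k' + j) × MatIdx (k' + j) =>
                      ∑ l : MatIdx (k' + j), ((g⁻¹ : Matrix.GeneralLinearGroup (MatIdx (k' + j)) ℂ) :
                        Matrix (MatIdx (k' + j)) (MatIdx (k' + j)) ℂ) p.1 l •
                          (MvPolynomial.X (l, p.2) : MvPolynomial (MatIdx (k' + j) × MatIdx (k' + j)) ℂ)).toLinearMap -
                    weightChar ((Weight.dualOfPartition ((k' + j) * (k' + j)) (rowLift lam j)).toMatIdx : Weight (MatIdx (k' + j))) g •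
                      (LinearMap.id : MvPolynomial (MatIdx (k' + j) × MatIdx (k' + j)) ℂ →ₗ[ℂ] MvPolynomial (MatIdx (k' + j) × MatIdx (k' + j)) ℂ)))) <
      orbitMultiplicity ℂ (paddedPerFormLex ℂ N (k' + j)) (k' + j) (partitionWeightLex (k' + j) (rowLift lam j))) :
    plethysmCoeff ℂ (MatIdx k') k' (partitionWeightLex k' lam) <
        orbitMultiplicity ℂ (paddedPerFormLex ℂ N (k' + j)) (k' + j) (partitionWeightLex (k' + j) (rowLift lam j)) ∧
      plethysmCoeff ℂ (MatIdx k') k' (partitionWeightLex k' lam) <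
        plethysmCoeff ℂ (MatIdx (k' + j)) (k' + j) (partitionWeightLex (k' + j) (rowLift lam j)) ∧
      k' < lam.sortedParts.getD 1 0 := by
  obtain ⟨-, -, hceil⟩ := plethysmFloor_sandwich j N hj hN lam hlam U r hU
  have hfloor := plethysmFloor_trunc j hj lam hlam U r hU
  have h1 : plethysmCoeff ℂ (MatIdx k') k' (partitionWeightLex k' lam) <
      orbitMultiplicity ℂ (paddedPerFormLex ℂ N (k' + j)) (k' + j) (partitionWeightLex (k' + j) (rowLift lam j)) :=
    lt_of_le_of_lt hfloor hflip
  have h2 : plethysmCoeff ℂ (MatIdx k') k' (partitionWeightLex k' lam) <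
      plethysmCoeff ℂ (MatIdx (k' + j)) (k' + j) (partitionWeightLex (k' + j) (rowLift lam j)) :=
    lt_of_lt_of_le h1 hceil
  refine ⟨h1, h2, ?_⟩
  by_contra h3
  rw [not_lt] at h3
  rw [plethysmCoeff_rowLift_eq lam hlam h3 j] at h2
  exact lt_irrefl _ h2

end

end Summit.ValiantsHypothesis.ValiantsHypothesis.Theorems.ValuativeFlip
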